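import Summits.Ventures.CertifiedArithmetic.LowPrec.MX
import Summits.Ventures.CertifiedArithmetic.LowPrec.JRBridge

/-!
# When is the dot product of two MX blocks an exact accumulator value? (scales included)

HONEST FRAMING (venture CertifiedArithmetic / cell `pub-lowprec`): certified error envelopes and
provably optimal rounding/accumulation schemes for low-precision formats under stated cost models;
every table by two implementations; no hardware or vendor claims.

`MX.lean` proved that the ELEMENT dot product `∑ Pᵢ Qᵢ` of two MX blocks (`k = 32`, FP4/FP6
elements) is a `binary32` value. The full block dot product carries the two shared `E8M0` scales:
`dot a b = X · Y · ∑ Pᵢ Qᵢ = N · 2^(cX + cY - 254 + qexp_φ + qexp_ψ)` with `|N| ≤ k · max_φ · max_ψ`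
(`exists_int_dot`). It is therefore a value of an accumulator format `α` as soon as (i) the integer
fits the significand, `k · max_φ · max_ψ < 2^p_α`, (ii) the combined exponent is not below `α`'s
quantum exponent, and (iii) the magnitude is within `α`'s range (`exists_toRat_eq_dot`) — for
`binary32` and MXFP4 / MXFP6 (`E3M2`, `E2M3`) blocks this reads `cX + cY ≥ 107 / 113 / 111` and
`|dot| ≤ maxRat` (`E2M1_dot_exact_in_Binary32` etc.). Condition (ii) is NOT vacuous: two MXFP4 blocks
with the smallest scale code `0` and all elements `1` have `dot = 32 · 2^-254`, below the `binary32`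
quantum `2^-149`, hence not a `binary32` value (`E2M1_dot_not_exact_of_small_scales`). Consequence
for MX GEMMs (no new theorem needed): when every block product is a `binary32` value, accumulating
`K` of them in `binary32` in ANY order is governed by `MiniFloat.abs_eval_sub_exact_le_sharp`
(AccumulateSharp.lean): `|ŝ - s| ≤ (K-1)·u/(1+u)·Σ|dotⱼ|`, `u = 2^-24`, nodes in range.
-/

namespace Literature.ComputerArithmetic.FloatingPoint

namespace MXBlock

open Finset
open Literature.ComputerArithmetic.JeannerodRump2018

variable {φ ψ : Format} {k : ℕ}

/-- STRUCTURE OF THE BLOCK DOT PRODUCT, scales included: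
`dot a b = N · 2^(cX + cY - 254 + qexp_φ + qexp_ψ)` with `|N| ≤ k · max_φ · max_ψ`.
[cite: RouhaniEtAl2023MX, §2] -/
theorem exists_int_dot (a : MXBlock φ k) (b : MXBlock ψ k) :
    ∃ N : ℤ, dot a b = (N : ℚ) * (2 : ℚ) ^ (((a.scale.code : ℤ) + b.scale.code - 254)
      + (φ.qexp + ψ.qexp)) ∧ |N| ≤ (k * (φ.maxScaled * ψ.maxScaled) : ℕ) := by
  obtain ⟨N, hN, hNle⟩ := exists_int_elemDot a b
  refine ⟨N, ?_, hNle⟩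
  rw [dot_eq_scale_mul_elemDot, hN]
  unfold E8M0.toRat
  have h2 : (2 : ℚ) ≠ 0 := by norm_num
  simp only [zpow_add₀ h2, zpow_sub₀ h2, zpow_ofNat]
  ring

/-- EXACTNESS CRITERION FOR THE SCALED BLOCK PRODUCT: if `k · max_φ · max_ψ < 2^(m_α + 1)` (the
integer fits the significand), the combined exponent `cX + cY - 254 + qexp_φ + qexp_ψ` is at least
`qexp_α` (no bits below `α`'s quantum) and `|dot a b| ≤ maxRat_α`, then `dot a b` is the value of a
datum of `α`. [folklore] -/
theorem exists_toRat_eq_dot {α : Format} (a : MXBlock φ k) (b : MXBlock ψ k)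
    (hsig : k * (φ.maxScaled * ψ.maxScaled) < 2 ^ (α.manBits + 1))
    (hexp : α.qexp ≤ ((a.scale.code : ℤ) + b.scale.code - 254) + (φ.qexp + ψ.qexp))
    (hrange : |dot a b| ≤ α.maxRat) : ∃ z : MiniFloat α, z.toRat = dot a b := by
  obtain ⟨N, hN, hNle⟩ := exists_int_dot a b
  have hNlt : |N| < 2 ^ (α.manBits + 1) := by
    have : ((k * (φ.maxScaled * ψ.maxScaled) : ℕ) : ℤ) < ((2 ^ (α.manBits + 1) : ℕ) : ℤ) := by
      exact_mod_cast hsig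
    push_cast at this
    exact lt_of_le_of_lt hNle this
  have hF : IsFloat (α.manBits + 1) α.qexp (dot a b) := ⟨N, _, hNlt, hexp, hN⟩
  exact MiniFloat.exists_toRat_eq_of_isFloat hF hrange

/-- MXFP4 (`E2M1`, `k = 32`) block product in `binary32`: exact whenever the scale codes satisfy
`cX + cY ≥ 107` (i.e. `X·Y ≥ 2^-147`) and `|dot| ≤ maxRat`. [folklore] -/
theorem E2M1_dot_exact_in_Binary32 (a b : MXBlock Format.E2M1 32)
    (hc : 107 ≤ a.scale.code + b.scale.code) (hrange : |dot a b| ≤ Format.Binary32.maxRat) :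
    ∃ z : MiniFloat Format.Binary32, z.toRat = dot a b := by
  refine exists_toRat_eq_dot a b (by decide +kernel) ?_ hrange
  have h1 : Format.Binary32.qexp = -149 := by decide
  have h2 : Format.E2M1.qexp = -1 := by decide
  rw [h1, h2]; omega

/-- MXFP6 `E3M2` (`k = 32`) block product in `binary32`: exact whenever `cX + cY ≥ 113` and
`|dot| ≤ maxRat`. [folklore] -/
theorem E3M2_dot_exact_in_Binary32 (a b : MXBlock Format.E3M2 32)
    (hc : 113 ≤ a.scale.code + b.scale.code) (hrange : |dot a b| ≤ Format.Binary32.maxRat) :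
    ∃ z : MiniFloat Format.Binary32, z.toRat = dot a b := by
  refine exists_toRat_eq_dot a b (by decide +kernel) ?_ hrange
  have h1 : Format.Binary32.qexp = -149 := by decide
  have h2 : Format.E3M2.qexp = -4 := by decide
  rw [h1, h2]; omega

/-- MXFP6 `E2M3` (`k = 32`) block product in `binary32`: exact whenever `cX + cY ≥ 111` and
`|dot| ≤ maxRat`. [folklore] -/
theorem E2M3_dot_exact_in_Binary32 (a b : MXBlock Format.E2M3 32)
    (hc : 111 ≤ a.scale.code + b.scale.code) (hrange : |dot a b| ≤ Format.Binary32.maxRat) :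
    ∃ z : MiniFloat Format.Binary32, z.toRat = dot a b := by
  refine exists_toRat_eq_dot a b (by decide +kernel) ?_ hrange
  have h1 : Format.Binary32.qexp = -149 := by decide
  have h2 : Format.E2M3.qexp = -3 := by decide
  rw [h1, h2]; omega

/-- THE EXPONENT CONDITION IS NEEDED: two MXFP4 blocks with the smallest scale (code `0`, value
`2^-127`) and all 32 elements equal to `1` have `dot = 32 · 2^-254 = 2^-249`, which is nonzero and
below the `binary32` quantum `2^-149` — not a `binary32` value (an FP32 accumulator would see `0` or
the least subnormal, depending on the rounding). [folklore] -/
theorem E2M1_dot_not_exact_of_small_scales :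
    ∃ a b : MXBlock Format.E2M1 32, ¬ ∃ z : MiniFloat Format.Binary32, z.toRat = dot a b := by
  let blk : MXBlock Format.E2M1 32 := ⟨⟨0, by decide⟩, fun _ => roundNE Format.E2M1 1⟩
  have hone : (roundNE Format.E2M1 1).toRat = 1 := by decide +kernel
  have hdot : dot blk blk = 32 * (2 : ℚ) ^ (-254 : ℤ) := by
    simp only [blk, dot, val, hone, E8M0.toRat, mul_one, Finset.sum_const, Finset.card_univ,
      Fintype.card_fin, nsmul_eq_mul]
    norm_num
  refine ⟨blk, blk, ?_⟩
  rintro ⟨z, hz⟩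
  have hne : z.toRat ≠ 0 := by rw [hz, hdot]; positivity
  have h1 := MiniFloat.quantum_le_abs_toRat z hne
  have hq : Format.Binary32.quantum = (2 : ℚ) ^ (-149 : ℤ) := by
    unfold Format.quantum; rw [show Format.Binary32.qexp = -149 by decide]
  rw [hz, hdot, hq, abs_of_pos (by positivity)] at h1
  have : (32 : ℚ) * (2 : ℚ) ^ (-254 : ℤ) < (2 : ℚ) ^ (-149 : ℤ) := by norm_num
  linarith

end MXBlock

end Literature.ComputerArithmetic.FloatingPoint
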